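import Summits.HodgeConjecture.CorCM.IrreducibleOddWeightsMaximalAdditive
import Summits.HodgeConjecture.CorCM.IrreducibleOddWeightsCMFields
import Literature.AlgebraicGeometry.Pohlmann1968.CMFamilyRankSlots
import HarnessLib

/-!
# CM fields: a sub-product has the Hodge group of the whole product iff the dropped type vectors are equivariant
# images of the kept ones — and then the product carries exceptional Hodge classes

COR-CM (cell `pub-hodgecm2`, binder seat `b16` gen 56, count-neutral claim MAX-NONDEG (D-RANK), file F4 — CM dress of
F1 `CorCM/IrreducibleOddWeightsRestriction` for the action of `Aut(ℂ)` on `⊔_i Hom(K_i, ℂ)`; theorems only, no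
definition, no named fact, no `sorry`).  NEW as stated, hence under `Summits/`.  HONEST FRAMING: "rank of a family of
CM types / exceptional Hodge classes for NAMED configurations" (kernel, unconditional); NO hypothesis on the CM fields
`K_i` (any fields, any degrees, any types); `HC_CM` is neither used nor asserted.

For CM types `Φ_i` of CM fields `K_i` (`i ∈ I`) write `u_i = 𝟙_{Φ_i} − 𝟙_{Φ̄_i} ∈ ℚ^{Hom(K_i, ℂ)}` and
`rank(Φ) = cmFamilyRank Φ = dim MT(∏_i A_i)` for realisations `A_i` of `(K_i, Φ_i)`.  The tree has
`rank(Φ ∘ ι) ≤ rank(Φ)` for every slot map `ι` (`Pohlmann1968/CMFamilyRankSubfamilies`,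
`CMAlgebra.cmFamilyRank_comp_le`: a sub-product never has the larger Mumford–Tate group).  This file decides EQUALITY:

* §1 **`cmFamilyRank_eq_comp_iff`** — for every slot map `ι : J → I`: `rank(Φ) = rank(Φ ∘ ι)` IFF every `u_i` is an
  `Aut(ℂ)`-EQUIVARIANT COMBINATION `u_i = Σ_j φ_ij(u_{ι j})` (`φ_ij : ℚ^{Hom(K_{ι j}, ℂ)} → ℚ^{Hom(K_i, ℂ)}` linear,
  commuting with `Aut(ℂ)`); sub-collection form **`cmFamilyRank_eq_restrict_iff`** (`T ⊆ I`; generation asked only of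
  the dropped `u_i`, `i ∉ T`): on Mumford–Tate groups, `MT(∏_I A_i) → MT(∏_T A_i)` is an isogeny iff the type vectors
  of the dropped factors are equivariant images of those of the kept ones.
* §2 **`not_isNondegenerateFamily_of_generated`** — if ONE type vector `u_{i₀}` is an equivariant combination of the
  OTHERS, the family is DEGENERATE (`rank(Φ) = rank(Φ|_{≠ i₀}) ≤ Σ_{i ≠ i₀} [K_i:ℚ]/2 + 1`); hence
  (**`exists_exceptional_prod_of_generated`**) for SIMPLE, PAIRWISE NON-ISOGENOUS realisations some product
  `⨁_{j<N} A_{π j}` carries an EXCEPTIONAL Hodge class (a rational `(m,m)` class outside `Dᵐ`), and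
  (**`not_forall_prod_hodgeClassSpan_eq_of_generated`**) `B• = D•` fails on some product.  This is the common form of
  the tree's degenerate configurations built from one equivariant map (quadratic towers `CMTypeRankQuadraticTowerDegenerate`,
  reflex incidence `ReflexSlotRankCollapse`, shared characters): ANY number of source factors, ANY equivariant maps.
* §4 **`cmFamilyRank_eq_cmTypeRank_iff`** — ALL FACTORS DOMINATED BY ONE: `dim MT(∏_I A_i) = dim MT(A_{i₁})` IFF every
  `u_i` is an equivariant image `φ_i(u_{i₁})`; then (two or more members) the family is degenerate
  (`not_isNondegenerateFamily_of_cmFamilyRank_eq_cmTypeRank`, `exists_exceptional_prod_of_cmFamilyRank_eq_cmTypeRank`).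
* `cmFamilyRank_eq_restrict_of_generated` is the rank form used by the sequel F5
  `CorCM/IrreducibleOddWeightsDRankCMFields` ((IRR) fields: the converse structure — every maximal nondegenerate
  sub-collection generates).

## References

* [Gordon1999HodgeAVSurvey] B. B. Gordon, *A survey of the Hodge conjecture for abelian varieties*, §3 Theorem (Imai,
  Murty) with proof, 7.5–7.7 (exceptional classes on degenerate products), 7.6.1.
* [Deligne1982HodgeCycles] P. Deligne, *Hodge cycles on abelian varieties*, LNM 900 (1982), I Ex. 3.7 (c).
* [MoonenZarhin1999LowDim] B. Moonen, Yu. Zarhin, *Hodge classes on abelian varieties of low dimension*, Math. Ann.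
  315 (1999), §3 (3.1).
* [Serre1977] J.-P. Serre, *Linear Representations of Finite Groups*, GTM 42 (1977), §1.3 Thm. 1.
-/

set_option autoImplicit false

noncomputable section

open scoped BigOperators

open CategoryTheory CategoryTheory.Limits NumberField

namespace Summit.HodgeConjecture.CorCM

open Literature.NumberTheory.ComplexMultiplication
open Literature.AlgebraicGeometry.Motives (AbelianVariety CMType)
open Literature.AlgebraicGeometry.HodgeTheory
open Literature.AlgebraicGeometry.ComplexMultiplication (IsCMTypeRealisation)
open Literature.AlgebraicGeometry.Pohlmann1968
open Literature.AlgebraicGeometry.VanGeemen1994 (hodgeClassSpan)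
open Literature.Barriers.HodgeConjecture (divisorClassesSpan)
open GenericCMField

variable {I : Type} [Fintype I] [DecidableEq I] {K : I → Type} [∀ i, Field (K i)] [∀ i, NumberField (K i)]
  [∀ i, IsCMField (K i)]

/-! ## §1 Equality of ranks along a slot map ⟺ equivariant generation -/

section Reindex

variable {J : Type} [Fintype J] [DecidableEq J]

omit [DecidableEq I] in
/-- **`rank(Φ) = rank(Φ ∘ ι)` ⟺ every type vector is an `Aut(ℂ)`-equivariant combination of the `u_{ι j}`** — for
every slot map `ι : J → I` (sub-products for `ι` injective).  On Mumford–Tate groups: `MT(∏_I A_i) ↠ MT(∏_J A_{ι j})`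
is an isogeny iff `u_i = Σ_j φ_ij(u_{ι j})` with equivariant `φ_ij` for all `i`.
[cite: Gordon1999HodgeAVSurvey, §3 Theorem (proof) and 7.5–7.7] [cite: Serre1977, §1.3 Thm. 1] -/
theorem cmFamilyRank_eq_comp_iff [Nonempty J] (Φ : ∀ i, CMType (K i)) (ι : J → I) :
    CMAlgebra.cmFamilyRank Φ = CMAlgebra.cmFamilyRank (fun j => Φ (ι j)) ↔
      ∃ φ : ∀ (i : I) (j : J), ((K (ι j) →+* ℂ) → ℚ) →ₗ[ℚ] ((K i →+* ℂ) → ℚ),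
        (∀ i j (g : ℂ ≃+* ℂ) (f : (K (ι j) →+* ℂ) → ℚ), φ i j (fun y => f (g • y)) = fun z => φ i j f (g • z)) ∧
        ∀ i, antiVec (Φ i).1 (1 : ℂ ≃+* ℂ) = ∑ j, φ i j (antiVec (Φ (ι j)).1 (1 : ℂ ≃+* ℂ)) := by
  obtain ⟨j⟩ := ‹Nonempty J›
  obtain ⟨s⟩ : Nonempty (K (ι j) →+* ℂ) := inferInstance
  haveI : Nonempty (Σ j, (K (ι j) →+* ℂ)) := ⟨⟨j, s⟩⟩
  exact IrrOdd.typeRank_sigmaType_eq_reindex_iff (E := fun i => K i →+* ℂ) (Φ := fun i => (Φ i).1)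
    (fun i => isCMTypeWith_conj (Φ i)) ι

end Reindex

/-! ## §2 Sub-collections: generation off `T` -/

section Restrict

/-- **Generation off `T` ⟹ `rank(Φ) = rank(Φ|_T)`**: if every dropped type vector `u_i` (`i ∉ T`) is an
`Aut(ℂ)`-equivariant combination of the kept ones, the sub-product `∏_{i∈T} A_i` already has the Mumford–Tate group
of `∏_I A_i` (up to isogeny). [cite: Gordon1999HodgeAVSurvey, §3 Theorem (proof) and 7.5–7.7] -/
theorem cmFamilyRank_eq_restrict_of_generated (Φ : ∀ i, CMType (K i)) (T : Finset I) (hT : T.Nonempty)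
    (φ : ∀ (i : I) (j : T), ((K j.1 →+* ℂ) → ℚ) →ₗ[ℚ] ((K i →+* ℂ) → ℚ))
    (hφ : ∀ i j (g : ℂ ≃+* ℂ) (f : (K j.1 →+* ℂ) → ℚ), φ i j (fun y => f (g • y)) = fun z => φ i j f (g • z))
    (hgen : ∀ i, i ∉ T → antiVec (Φ i).1 (1 : ℂ ≃+* ℂ) = ∑ j, φ i j (antiVec (Φ j.1).1 (1 : ℂ ≃+* ℂ))) :
    CMAlgebra.cmFamilyRank Φ = CMAlgebra.cmFamilyRank (fun j : T => Φ j.1) := by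
  obtain ⟨j₀, hj₀⟩ := hT
  obtain ⟨s₀⟩ : Nonempty (K j₀ →+* ℂ) := inferInstance
  haveI : Nonempty (Σ j : T, (K j.1 →+* ℂ)) := ⟨⟨⟨j₀, hj₀⟩, s₀⟩⟩
  haveI : Nonempty (Σ i, (K i →+* ℂ)) := ⟨⟨j₀, s₀⟩⟩
  change typeRank (ℂ ≃+* ℂ) (sigmaType fun i => (Φ i).1) =
    typeRank (ℂ ≃+* ℂ) (sigmaType fun j : T => (Φ j.1).1)
  rw [(IsCMTypeWith.sigmaType fun i => isCMTypeWith_conj (Φ i)).typeRank_eq_finrank_antiSpan_add_one,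
    (IsCMTypeWith.sigmaType (E := fun j : T => K j.1 →+* ℂ)
      fun j => isCMTypeWith_conj (Φ j.1)).typeRank_eq_finrank_antiSpan_add_one,
    IrrOdd.finrank_antiSpan_sigmaType_eq_restrict_of_exists_generated (E := fun i => K i →+* ℂ) (fun i => (Φ i).1)
      (· ∈ T) fun i hi => ⟨φ i, hφ i, hgen i hi⟩]

/-- **`rank(Φ) = rank(Φ|_T)` ⟺ generation**: the sub-product over `T` has the Mumford–Tate group of the whole product
(up to isogeny) iff EVERY type vector is an equivariant combination of the `u_j`, `j ∈ T` (for `j ∈ T` trivially so).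
[cite: Gordon1999HodgeAVSurvey, §3 Theorem (proof) and 7.5–7.7] [cite: Serre1977, §1.3 Thm. 1] -/
theorem cmFamilyRank_eq_restrict_iff (Φ : ∀ i, CMType (K i)) (T : Finset I) (hT : T.Nonempty) :
    CMAlgebra.cmFamilyRank Φ = CMAlgebra.cmFamilyRank (fun j : T => Φ j.1) ↔
      ∃ φ : ∀ (i : I) (j : T), ((K j.1 →+* ℂ) → ℚ) →ₗ[ℚ] ((K i →+* ℂ) → ℚ),
        (∀ i j (g : ℂ ≃+* ℂ) (f : (K j.1 →+* ℂ) → ℚ), φ i j (fun y => f (g • y)) = fun z => φ i j f (g • z)) ∧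
        ∀ i, antiVec (Φ i).1 (1 : ℂ ≃+* ℂ) = ∑ j, φ i j (antiVec (Φ j.1).1 (1 : ℂ ≃+* ℂ)) := by
  haveI : Nonempty (T : Type) := hT.coe_sort
  exact cmFamilyRank_eq_comp_iff Φ (Subtype.val : T → I)

end Restrict

/-! ## §3 One type vector generated by the others ⟹ degenerate family ⟹ exceptional classes -/

section Generated

/-- **A family in which one type vector is an `Aut(ℂ)`-equivariant combination of the OTHERS is DEGENERATE**:
`rank(Φ) = rank(Φ|_{≠ i₀}) ≤ Σ_{i ≠ i₀} [K_i:ℚ]/2 + 1 < Σ_i [K_i:ℚ]/2 + 1`.  On Hodge groups: `A_{i₀}` adds no dimension to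
`Hg(∏_{i ≠ i₀} A_i)`. [cite: Gordon1999HodgeAVSurvey, 7.5–7.7] [cite: MoonenZarhin1999LowDim, §3 (3.1)] -/
theorem not_isNondegenerateFamily_of_generated (Φ : ∀ i, CMType (K i)) {i₀ : I}
    (φ : ∀ j : {i // i ≠ i₀}, ((K j.1 →+* ℂ) → ℚ) →ₗ[ℚ] ((K i₀ →+* ℂ) → ℚ))
    (hφ : ∀ j (g : ℂ ≃+* ℂ) (f : (K j.1 →+* ℂ) → ℚ), φ j (fun y => f (g • y)) = fun z => φ j f (g • z))
    (hgen : antiVec (Φ i₀).1 (1 : ℂ ≃+* ℂ) = ∑ j, φ j (antiVec (Φ j.1).1 (1 : ℂ ≃+* ℂ))) :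
    ¬ CMAlgebra.IsNondegenerateFamily Φ := by
  classical
  intro hnd
  obtain ⟨s₀⟩ : Nonempty (K i₀ →+* ℂ) := inferInstance
  haveI : Nonempty (Σ i, (K i →+* ℂ)) := ⟨⟨i₀, s₀⟩⟩
  -- the span of the family is that of the sub-family off `i₀`
  have heq := IrrOdd.finrank_antiSpan_sigmaType_eq_restrict_of_exists_generated (G := ℂ ≃+* ℂ)
    (E := fun i => K i →+* ℂ) (fun i => (Φ i).1) (· ≠ i₀) fun i hi => by
      obtain rfl : i = i₀ := not_not.1 hi
      exact ⟨φ, hφ, hgen⟩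
  -- dimension count: `dim U(Σ) = Σ_i [K_i:ℚ]/2`
  have hrank : CMAlgebra.cmFamilyRank Φ =
      Module.finrank ℚ (antiSpan (ℂ ≃+* ℂ) (sigmaType fun i => (Φ i).1)) + 1 :=
    (IsCMTypeWith.sigmaType fun i => isCMTypeWith_conj (Φ i)).typeRank_eq_finrank_antiSpan_add_one
  have hnd' : Module.finrank ℚ (antiSpan (ℂ ≃+* ℂ) (sigmaType fun j : {i // i ≠ i₀} => (Φ j.1).1)) + 1 =
      (∑ i, Module.finrank ℚ (K i)) / 2 + 1 := by
    rw [← heq, ← hrank]; exact hnd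
  -- the sub-family's span has dimension at most `|⊔_{i ≠ i₀} Hom(K_i, ℂ)|/2`
  have hsub : Module.finrank ℚ (antiSpan (ℂ ≃+* ℂ) (sigmaType fun j : {i // i ≠ i₀} => (Φ j.1).1)) + 1 ≤
      Fintype.card (Σ j : {i // i ≠ i₀}, (K j.1 →+* ℂ)) / 2 + 1 := by
    rcases isEmpty_or_nonempty (Σ j : {i // i ≠ i₀}, (K j.1 →+* ℂ)) with hE | hE
    · have h0 := Submodule.finrank_le (antiSpan (ℂ ≃+* ℂ) (sigmaType fun j : {i // i ≠ i₀} => (Φ j.1).1))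
      rw [Module.finrank_fintype_fun_eq_card, Fintype.card_eq_zero, Nat.le_zero] at h0
      rw [h0]
      exact Nat.succ_le_succ (Nat.zero_le _)
    · have h := (IsCMTypeWith.sigmaType (E := fun j : {i // i ≠ i₀} => K j.1 →+* ℂ)
        fun j => isCMTypeWith_conj (Φ j.1)).typeRank_le
      rwa [(IsCMTypeWith.sigmaType (E := fun j : {i // i ≠ i₀} => K j.1 →+* ℂ)
        fun j => isCMTypeWith_conj (Φ j.1)).typeRank_eq_finrank_antiSpan_add_one] at h
  -- `|⊔_{i ≠ i₀} Hom(K_i, ℂ)| + [K_{i₀}:ℚ] = Σ_i [K_i:ℚ]` and `[K_{i₀}:ℚ] ≥ 2`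
  have hcard : Fintype.card (Σ j : {i // i ≠ i₀}, (K j.1 →+* ℂ)) + Module.finrank ℚ (K i₀) =
      ∑ i, Module.finrank ℚ (K i) := by
    rw [Fintype.card_sigma, ← Finset.sum_erase_add _ _ (Finset.mem_univ i₀),
      Finset.sum_subtype (Finset.univ.erase i₀) (p := fun i => i ≠ i₀) (fun i => by simp)
        fun i => Module.finrank ℚ (K i)]
    exact congrArg₂ (· + ·) (Finset.sum_congr rfl fun j _ => Embeddings.card (K j.1) ℂ) rfl
  have h2 : 2 ≤ Module.finrank ℚ (K i₀) := by
    rw [← Embeddings.card (K i₀) ℂ]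
    exact Fintype.one_lt_card_iff_nontrivial.2
      ⟨⟨(starRingAut : ℂ ≃+* ℂ) • s₀, s₀, (isCMTypeWith_conj (Φ i₀)).rho_smul_ne s₀⟩⟩
  omega

variable {Φ : ∀ i, CMType (K i)} {A : I → AbelianVariety ℂ} {ι : ∀ i, 𝓞 (K i) →+* End (A i)}
  {θ : ∀ i, K i →+* Module.End ℂ (complexBetti (A i).X 1)}

/-- **SIMPLE, PAIRWISE NON-ISOGENOUS CM abelian varieties one of whose type vectors is an `Aut(ℂ)`-equivariant
combination of the others' carry an EXCEPTIONAL Hodge class on some product `⨁_{j<N} A_{π j}`** (a rational `(m,m)`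
class outside `Dᵐ`) — any CM fields, any number of source factors, any equivariant maps.
[cite: Gordon1999HodgeAVSurvey, 7.5–7.7] [cite: MoonenZarhin1999LowDim, §3 (3.1)] -/
theorem exists_exceptional_prod_of_generated [Nonempty I] {i₀ : I}
    (φ : ∀ j : {i // i ≠ i₀}, ((K j.1 →+* ℂ) → ℚ) →ₗ[ℚ] ((K i₀ →+* ℂ) → ℚ))
    (hφ : ∀ j (g : ℂ ≃+* ℂ) (f : (K j.1 →+* ℂ) → ℚ), φ j (fun y => f (g • y)) = fun z => φ j f (g • z))
    (hgen : antiVec (Φ i₀).1 (1 : ℂ ≃+* ℂ) = ∑ j, φ j (antiVec (Φ j.1).1 (1 : ℂ ≃+* ℂ)))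
    (hA : ∀ i, IsCMTypeRealisation (Φ i) (A i) (ι i) (θ i)) (hs : ∀ i, (A i).IsSimple)
    (hniso : ∀ i j, i ≠ j → ¬ AbelianVariety.IsIsogenous (A i) (A j)) :
    ∃ (N : ℕ) (π : Fin N → I) (m : ℕ) (c : complexBetti (⨁ fun j : Fin N => A (π j)).X (2 * m)),
      IsRationalClass c ∧
      IsOfHodgeType (⨁ fun j : Fin N => A (π j)).dim (⨁ fun j : Fin N => A (π j)).X (2 * m) m m c ∧
      c ∉ divisorClassesSpan (⨁ fun j : Fin N => A (π j)).X (⨁ fun j : Fin N => A (π j)).dim m :=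
  CMAlgebra.exists_exceptional_prod_of_not_isNondegenerateFamily
    (CMAlgebra.isSeparatingFamily_of_isSimple_of_pairwise_not_isIsogenous hA hs hniso)
    (not_isNondegenerateFamily_of_generated Φ φ hφ hgen) hA

/-- **… so `B• = D•` FAILS on some product `⨁_{j<N} A_{π j}`.** [cite: Gordon1999HodgeAVSurvey, 7.5–7.7] -/
theorem not_forall_prod_hodgeClassSpan_eq_of_generated [Nonempty I] {i₀ : I}
    (φ : ∀ j : {i // i ≠ i₀}, ((K j.1 →+* ℂ) → ℚ) →ₗ[ℚ] ((K i₀ →+* ℂ) → ℚ))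
    (hφ : ∀ j (g : ℂ ≃+* ℂ) (f : (K j.1 →+* ℂ) → ℚ), φ j (fun y => f (g • y)) = fun z => φ j f (g • z))
    (hgen : antiVec (Φ i₀).1 (1 : ℂ ≃+* ℂ) = ∑ j, φ j (antiVec (Φ j.1).1 (1 : ℂ ≃+* ℂ)))
    (hA : ∀ i, IsCMTypeRealisation (Φ i) (A i) (ι i) (θ i)) (hs : ∀ i, (A i).IsSimple)
    (hniso : ∀ i j, i ≠ j → ¬ AbelianVariety.IsIsogenous (A i) (A j)) :
    ¬ ∀ (N : ℕ) (π : Fin N → I) (m : ℕ),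
      hodgeClassSpan (⨁ fun j : Fin N => A (π j)).dim (⨁ fun j : Fin N => A (π j)).X m =
        divisorClassesSpan (⨁ fun j : Fin N => A (π j)).X (⨁ fun j : Fin N => A (π j)).dim m := by
  rw [← CMAlgebra.isNondegenerateFamily_iff_forall_prod_hodgeClassSpan_eq
    (CMAlgebra.isSeparatingFamily_of_isSimple_of_pairwise_not_isIsogenous hA hs hniso) hA]
  exact not_isNondegenerateFamily_of_generated Φ φ hφ hgen

end Generated

/-! ## §4 All factors dominated by one -/

section Dominated

omit [Fintype I] [DecidableEq I] [∀ i, IsCMField (K i)] in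
/-- The rank of the one-member family `(Ψ)` over a one-point index is `rank(Ψ)` (Kubota's rank along the equivariant
bijection `⊔_{pt} Hom(k, ℂ) → Hom(k, ℂ)`). [cite: Deligne1982HodgeCycles, I Ex. 3.7 (c)] -/
theorem cmFamilyRank_punit_eq_cmTypeRank {k : Type} [Field k] [NumberField k] (Ψ : CMType k) :
    CMAlgebra.cmFamilyRank (K := fun _ : PUnit => k) (fun _ => Ψ) = cmTypeRank Ψ := by
  change typeRank (ℂ ≃+* ℂ) ((fun x : (Σ _ : PUnit, (k →+* ℂ)) => x.2) ⁻¹' Ψ.1) = typeRank (ℂ ≃+* ℂ) Ψ.1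
  exact typeRank_preimage_eq_of_surjective (G := ℂ ≃+* ℂ) Ψ.1 (fun x : (Σ _ : PUnit, (k →+* ℂ)) => x.2)
    (fun τ x => by obtain ⟨u, s⟩ := x; rfl) fun s => ⟨⟨PUnit.unit, s⟩, rfl⟩

omit [DecidableEq I] in
/-- **ALL FACTORS DOMINATED BY ONE: `dim MT(∏_I A_i) = dim MT(A_{i₁})` ⟺ every type vector `u_i` is an
`Aut(ℂ)`-equivariant image `φ_i(u_{i₁})` of the one type vector `u_{i₁}`** (any CM fields; F1 along the constant slot
map `pt ↦ i₁`). [cite: Gordon1999HodgeAVSurvey, §3 Theorem (proof), 7.5–7.7 and 9.1] [cite: Serre1977, §1.3 Thm. 1] -/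
theorem cmFamilyRank_eq_cmTypeRank_iff (Φ : ∀ i, CMType (K i)) (i₁ : I) :
    CMAlgebra.cmFamilyRank Φ = cmTypeRank (Φ i₁) ↔
      ∃ φ : ∀ i : I, ((K i₁ →+* ℂ) → ℚ) →ₗ[ℚ] ((K i →+* ℂ) → ℚ),
        (∀ i (g : ℂ ≃+* ℂ) (f : (K i₁ →+* ℂ) → ℚ), φ i (fun y => f (g • y)) = fun z => φ i f (g • z)) ∧
        ∀ i, antiVec (Φ i).1 (1 : ℂ ≃+* ℂ) = φ i (antiVec (Φ i₁).1 (1 : ℂ ≃+* ℂ)) := by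
  rw [← cmFamilyRank_punit_eq_cmTypeRank (Φ i₁)]
  refine (cmFamilyRank_eq_comp_iff Φ (fun _ : PUnit => i₁)).trans ⟨?_, ?_⟩
  · rintro ⟨φ, hφ, hgen⟩
    exact ⟨fun i => φ i PUnit.unit, fun i g f => hφ i _ g f, fun i => by rw [hgen i, Fintype.sum_unique]⟩
  · rintro ⟨φ, hφ, hgen⟩
    exact ⟨fun i _ => φ i, fun i _ g f => hφ i g f, fun i => by rw [hgen i, Fintype.sum_unique]⟩

/-- **… and then, with a second member, the family is DEGENERATE** (`rank(Φ) = rank(Φ_{i₁}) ≤ [K_{i₁}:ℚ]/2 + 1`, short of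
`Σ_i [K_i:ℚ]/2 + 1` by at least `[K_{i₀}:ℚ]/2 ≥ 1`). [cite: Gordon1999HodgeAVSurvey, 7.5–7.7] -/
theorem not_isNondegenerateFamily_of_cmFamilyRank_eq_cmTypeRank (Φ : ∀ i, CMType (K i)) {i₀ i₁ : I} (h01 : i₀ ≠ i₁)
    (h : CMAlgebra.cmFamilyRank Φ = cmTypeRank (Φ i₁)) : ¬ CMAlgebra.IsNondegenerateFamily Φ := by
  intro hnd
  rw [CMAlgebra.isNondegenerateFamily_iff, h] at hnd
  have hle := cmTypeRank_le (Φ i₁)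
  obtain ⟨s₀⟩ : Nonempty (K i₀ →+* ℂ) := inferInstance
  have h2 : 2 ≤ Module.finrank ℚ (K i₀) := by
    rw [← Embeddings.card (K i₀) ℂ]
    exact Fintype.one_lt_card_iff_nontrivial.2
      ⟨⟨(starRingAut : ℂ ≃+* ℂ) • s₀, s₀, (isCMTypeWith_conj (Φ i₀)).rho_smul_ne s₀⟩⟩
  have hsum : Module.finrank ℚ (K i₀) + Module.finrank ℚ (K i₁) ≤ ∑ i, Module.finrank ℚ (K i) := by
    rw [← Finset.sum_pair (f := fun i => Module.finrank ℚ (K i)) h01]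
    exact Finset.sum_le_sum_of_subset (Finset.subset_univ _)
  omega

variable {Φ : ∀ i, CMType (K i)} {A : I → AbelianVariety ℂ} {ι : ∀ i, 𝓞 (K i) →+* End (A i)}
  {θ : ∀ i, K i →+* Module.End ℂ (complexBetti (A i).X 1)}

/-- **Simple, pairwise non-isogenous CM abelian varieties ALL of whose type vectors are equivariant images of ONE of them
(two or more factors) carry an exceptional Hodge class on some product `⨁_{j<N} A_{π j}`.**
[cite: Gordon1999HodgeAVSurvey, 7.5–7.7] [cite: MoonenZarhin1999LowDim, §3 (3.1)] -/
theorem exists_exceptional_prod_of_cmFamilyRank_eq_cmTypeRank [Nonempty I] {i₀ i₁ : I} (h01 : i₀ ≠ i₁)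
    (h : CMAlgebra.cmFamilyRank Φ = cmTypeRank (Φ i₁))
    (hA : ∀ i, IsCMTypeRealisation (Φ i) (A i) (ι i) (θ i)) (hs : ∀ i, (A i).IsSimple)
    (hniso : ∀ i j, i ≠ j → ¬ AbelianVariety.IsIsogenous (A i) (A j)) :
    ∃ (N : ℕ) (π : Fin N → I) (m : ℕ) (c : complexBetti (⨁ fun j : Fin N => A (π j)).X (2 * m)),
      IsRationalClass c ∧
      IsOfHodgeType (⨁ fun j : Fin N => A (π j)).dim (⨁ fun j : Fin N => A (π j)).X (2 * m) m m c ∧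
      c ∉ divisorClassesSpan (⨁ fun j : Fin N => A (π j)).X (⨁ fun j : Fin N => A (π j)).dim m :=
  CMAlgebra.exists_exceptional_prod_of_not_isNondegenerateFamily
    (CMAlgebra.isSeparatingFamily_of_isSimple_of_pairwise_not_isIsogenous hA hs hniso)
    (not_isNondegenerateFamily_of_cmFamilyRank_eq_cmTypeRank Φ h01 h) hA

end Dominated

end Summit.HodgeConjecture.CorCM

end
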